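import Literature.InformationTheory.QuantumCodes.AbelianTwoBlockParameters
import Mathlib.RingTheory.AdjoinRoot
import Mathlib.RingTheory.Multiplicity
import Mathlib.RingTheory.UniqueFactorizationDomain.Multiplicative
import HarnessLib

/-!
# Wang–Pryadko 2022: the distance of a generalized-bicycle code is at most the distance of the
# cyclic code generated by `g(x) = (x^ℓ − 1)/gcd(a, b, x^ℓ − 1)` — proved

Source: R. Wang, L. P. Pryadko, *Distance bounds for generalized bicycle codes*, Symmetry **14**
(2022) 1348 = arXiv:2203.17216 [WangPryadko2022] (held text `paper:arxiv-2203.17216`), §3.1: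

> "Statement 1. The distance of the code `GB(a,b)` is the same as that of the associated AB code
> `css(H_X', H_Z)`, `d = d' = min(d_X', d_Z')`." (chunk p0006 L91–94)
> "In addition, the CSS distance `d_Z'` (and thus the distance `d` of the GB code) is bounded by the
> distance `d_g` of the linear cyclic code `𝒞_{g(x)}`. Statement 2. Let `d_g` denote the distance of
> the `𝔽_q`-linear cyclic code with the generating polynomial `g(x)` … Then the `Z`-distance of the
> `q`-ary AB code `css(H_X', H_Z)` satisfies `d_Z' ≤ d_g`. The formal proof in Sec. 6.3 amounts to a
> demonstration that for any non-zero code word `e(x) ∈ 𝒞_{g(x)}`, either `[e(x), 0]` or `[0, e(x)]`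
> is a non-trivial `Z`-vector in the AB code." (chunk p0006 L96–110; proof §6.3, chunk p0013 L113–141)

Here `h(x) = gcd(a(x), b(x), x^ℓ − 1)`, `g(x) h(x) = x^ℓ − 1`, `k = 2 deg h(x)` (chunk p0006 L40–48;
the tree's `PanteleevKalachev2021_prop1_holds` / `GBDim.rank_fromCols_circulant_add`).

## What is PROVED here (no named facts)

We prove the consequence **`d(GB(a,b)) ≤ d_g`** DIRECTLY on the GB code (no detour through the
"AB code" of Statement 1), in the strong form of §6.3: for the abelian two-block code
`H_X = [A|B]`, `H_Z = [Bᵀ|Aᵀ]`, `A = circulant a`, `B = circulant b` over the cyclic group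
`ℤ_ℓ` (`Fin ℓ`) and any field `F`,

* `GB.dvd_of_trivial_pair` — the polynomial heart: in `F[x]`, if `f ∣ a w₁`, `f ∣ e − b w₁`,
  `f ∣ b w₂`, `f ∣ e − a w₂` then `f ∣ e`. (Our proof: for every prime power `p^m ∣ f`, the
  multiplicities satisfy `v_p(b w₁) + v_p(a w₂) = v_p(a w₁) + v_p(b w₂) ≥ 2m`, so one of `b w₁`,
  `a w₂` is `≡ e` and `≡ 0 (mod p^m)`; assemble by coprime induction. §6.3's printed argument runs
  through the divisors `h/gcd(h, a₂)`, `h/gcd(h, b₂)`; the valuation form is equivalent and shorter.)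
* `GB.not_both_trivial` — for every `e ≠ 0` in `ker A ∩ ker B` (i.e. `a(x)e(x) ≡ b(x)e(x) ≡ 0`),
  the `Z`-type vectors `(e, 0)` and `(0, e)` (both in `ker H_X`) are NOT BOTH in the row space of
  `H_Z`: "either `[e(x),0]` or `[0,e(x)]` is a non-trivial `Z`-vector" — for EVERY cyclic group and
  EVERY field (no semisimplicity `gcd(ℓ, char F) = 1` needed).
* `GB.css_dZ_le_hammingNorm`, `GB.css_dX_le_hammingNorm` — hence over `𝔽₂`, for the tree's CSS code
  `AbelianTwoBlock.css a b` on `ℤ_ℓ`: `d_Z ≤ |e|` and `d_X ≤ |e|` for every such `e`; and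
  `GB.css_dZ_le_of_generator_dvd` — every non-zero `e(x) = i(x) g(x)` (a codeword of the cyclic code
  generated by `g = (x^ℓ − 1)/h`) is such an `e`, which is the printed `d ≤ d_g`.

Scope / honest framing. (1) The cyclic hypothesis is USED: for non-cyclic abelian `G` with
`char F ∣ |G|` the strong form fails (e.g. over `𝔽₂[ℤ₂ × ℤ₂]` there are pairs `a, b` and
`e ∈ ker A ∩ ker B ∖ 0` with both `(e,0)` and `(0,e)` stabilizers — qec-lit-3 g4 exhaustive check,
not typed); whether the WEAK form `d ≤ d(ker A ∩ ker B)` holds for every abelian group is not in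
print (it holds for all 791 certified abelian two-block census rows, HOME/lit notes), and is NOT
asserted here. (2) Statement 1 itself (`d = d'`) is not typed. (3) `d_g` is not computed here for any
instance; the theorem is the family inequality.
-/

namespace Literature.InformationTheory.QuantumCodes

namespace GB

open Matrix Polynomial

/-! ### The polynomial heart (valuation argument) -/

section Poly

variable {F : Type*} [Field F]

/-- Prime-power case: if `p^m ∣ a w₁`, `p^m ∣ b w₂`, `p^m ∣ e − b w₁`, `p^m ∣ e − a w₂` for a prime
`p`, then `p^m ∣ e` (as `v_p(b w₁) + v_p(a w₂) = v_p(a w₁) + v_p(b w₂) ≥ 2m`).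
[cite: WangPryadko2022, §6.3 proof of Statement 2 (arXiv:2203.17216 chunk p0013 L113–141), valuation form] -/
theorem prime_pow_dvd_of_trivial_pair {p a b e w₁ w₂ : F[X]} (hp : Prime p) {m : ℕ}
    (h1 : p ^ m ∣ a * w₁) (h2 : p ^ m ∣ e - b * w₁) (h3 : p ^ m ∣ b * w₂) (h4 : p ^ m ∣ e - a * w₂) :
    p ^ m ∣ e := by
  -- multiplicities
  have hprod : (2 * m : ℕ) ≤ emultiplicity p ((b * w₁) * (a * w₂)) := by
    have heq : (b * w₁) * (a * w₂) = (a * w₁) * (b * w₂) := by ring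
    rw [heq, emultiplicity_mul hp]
    have h1' := le_emultiplicity_of_pow_dvd h1
    have h3' := le_emultiplicity_of_pow_dvd h3
    calc ((2 * m : ℕ) : ℕ∞) = (m : ℕ∞) + (m : ℕ∞) := by push_cast; ring
      _ ≤ emultiplicity p (a * w₁) + emultiplicity p (b * w₂) := add_le_add h1' h3'
  rw [emultiplicity_mul hp] at hprod
  -- one of the two factors has multiplicity ≥ m
  by_cases hbw : (m : ℕ∞) ≤ emultiplicity p (b * w₁)
  · have : p ^ m ∣ b * w₁ := pow_dvd_of_le_emultiplicity hbw
    have := dvd_add h2 this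
    simpa using this
  · by_cases haw : (m : ℕ∞) ≤ emultiplicity p (a * w₂)
    · have : p ^ m ∣ a * w₂ := pow_dvd_of_le_emultiplicity haw
      have := dvd_add h4 this
      simpa using this
    · exfalso
      have hsum := ENat.add_lt_add (not_le.mp hbw) (not_le.mp haw)
      have h2m : ((2 * m : ℕ) : ℕ∞) = (m : ℕ∞) + (m : ℕ∞) := by push_cast; ring
      rw [h2m] at hprod
      exact absurd (lt_of_le_of_lt hprod hsum) (lt_irrefl _)

/-- **The polynomial heart of §6.3.** In `F[x]`: `f ∣ a w₁`, `f ∣ e − b w₁`, `f ∣ b w₂`, `f ∣ e − a w₂`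
imply `f ∣ e` (every prime power of `f` divides `e` by `prime_pow_dvd_of_trivial_pair`; assemble
over coprime factors). [cite: WangPryadko2022, §6.3 proof of Statement 2 "These conditions cannot be simultaneously satisfied, as in this case i(x) would be divisible by h(x)" (arXiv:2203.17216 chunk p0013 L130–141)] -/
theorem dvd_of_trivial_pair (f : F[X]) {a b e w₁ w₂ : F[X]}
    (h1 : f ∣ a * w₁) (h2 : f ∣ e - b * w₁) (h3 : f ∣ b * w₂) (h4 : f ∣ e - a * w₂) : f ∣ e := by
  induction f using UniqueFactorizationMonoid.induction_on_coprime with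
  | h0 =>
    -- `f = 0`: the congruences are equalities in the domain `F[x]`
    rw [zero_dvd_iff] at h1 h2 h3 h4 ⊢
    rcases mul_eq_zero.mp h1 with ha | hw
    · rw [ha, zero_mul, sub_zero] at h4; exact h4
    · rw [hw, mul_zero, sub_zero] at h2; exact h2
  | h1 hu => exact hu.dvd
  | hpr i hp => exact prime_pow_dvd_of_trivial_pair hp h1 h2 h3 h4
  | hcp hxy ihx ihy =>
    exact hxy.mul_dvd
      (ihx (dvd_trans (dvd_mul_right _ _) h1) (dvd_trans (dvd_mul_right _ _) h2)
        (dvd_trans (dvd_mul_right _ _) h3) (dvd_trans (dvd_mul_right _ _) h4))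
      (ihy (dvd_trans (dvd_mul_left _ _) h1) (dvd_trans (dvd_mul_left _ _) h2)
        (dvd_trans (dvd_mul_left _ _) h3) (dvd_trans (dvd_mul_left _ _) h4))

end Poly

/-! ### Circulant matrices over `ℤ_ℓ` and `F[x]/(x^ℓ − 1)`

The identification "multiplication by `circulant a` = multiplication by `a(x)` modulo `x^ℓ − 1`"
(coefficient vector ↦ polynomial is the tree's `GBDim.vecPoly`; the intertwining lemmas of
`AbelianTwoBlockCodes.lean` are file-private, so the few needed here are re-derived). -/

section Circ

variable {F : Type*} [Field F] {ℓ : ℕ}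

/-- `x^ℓ - 1` is monic. [folklore] -/
private theorem modulus_monic [NeZero ℓ] : ((X : F[X]) ^ ℓ - 1).Monic := by
  rw [← C_1]; exact monic_X_pow_sub_C (1 : F) (NeZero.ne ℓ)

/-- `deg (x^ℓ - 1) = ℓ`. [folklore] -/
private theorem natDegree_modulus [NeZero ℓ] : ((X : F[X]) ^ ℓ - 1).natDegree = ℓ := by
  rw [← C_1]; exact natDegree_X_pow_sub_C

/-- `x^ℓ = 1` in `F[x]/(x^ℓ − 1)`. [folklore] -/
private theorem root_pow_card [NeZero ℓ] : AdjoinRoot.root ((X : F[X]) ^ ℓ - 1) ^ ℓ = 1 := by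
  have h : AdjoinRoot.mk ((X : F[X]) ^ ℓ - 1) ((X : F[X]) ^ ℓ - 1) = 0 := AdjoinRoot.mk_self
  rw [map_sub, map_pow, AdjoinRoot.mk_X, map_one, sub_eq_zero] at h
  exact h

/-- `x^n = x^(n mod ℓ)` in `F[x]/(x^ℓ − 1)`. [folklore] -/
private theorem root_pow_eq_pow_mod [NeZero ℓ] (n : ℕ) :
    AdjoinRoot.root ((X : F[X]) ^ ℓ - 1) ^ n = AdjoinRoot.root ((X : F[X]) ^ ℓ - 1) ^ (n % ℓ) := by
  conv_lhs => rw [← Nat.div_add_mod n ℓ, pow_add, pow_mul, root_pow_card, one_pow, one_mul]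

/-- The power basis `1, x, …, x^{ℓ-1}` of `F[x]/(x^ℓ − 1)`, indexed by `Fin ℓ`. [folklore] -/
private noncomputable def xBasis (F : Type*) [Field F] (ℓ : ℕ) [NeZero ℓ] :
    Module.Basis (Fin ℓ) F (AdjoinRoot ((X : F[X]) ^ ℓ - 1)) :=
  (AdjoinRoot.powerBasis' (modulus_monic (F := F) (ℓ := ℓ))).basis.reindex
    (finCongr (natDegree_modulus (F := F) (ℓ := ℓ)))

/-- `xBasis i = x^i`. [folklore] -/
private theorem xBasis_apply [NeZero ℓ] (i : Fin ℓ) :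
    xBasis F ℓ i = AdjoinRoot.root ((X : F[X]) ^ ℓ - 1) ^ (i : ℕ) := by
  rw [xBasis, Module.Basis.reindex_apply, PowerBasis.coe_basis]
  simp [finCongr_symm, finCongr_apply]

/-- The coordinate isomorphism `φ : F^ℓ ≃ F[x]/(x^ℓ − 1)`, `v ↦ Σ v_i xⁱ`. [folklore] -/
private noncomputable def φ (F : Type*) [Field F] (ℓ : ℕ) [NeZero ℓ] :
    (Fin ℓ → F) ≃ₗ[F] AdjoinRoot ((X : F[X]) ^ ℓ - 1) :=
  (xBasis F ℓ).equivFun.symm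

/-- `φ v = Σ v_i xⁱ`. [folklore] -/
private theorem φ_apply [NeZero ℓ] (v : Fin ℓ → F) :
    φ F ℓ v = ∑ i : Fin ℓ, v i • AdjoinRoot.root ((X : F[X]) ^ ℓ - 1) ^ (i : ℕ) := by
  rw [φ, Module.Basis.equivFun_symm_apply]
  simp [xBasis_apply]

/-- `φ v` is the class of `GBDim.vecPoly v`. [folklore] -/
private theorem mk_vecPoly [NeZero ℓ] (v : Fin ℓ → F) :
    AdjoinRoot.mk ((X : F[X]) ^ ℓ - 1) (GBDim.vecPoly v) = φ F ℓ v := by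
  rw [φ_apply, GBDim.vecPoly, map_sum]
  refine Finset.sum_congr rfl fun i _ => ?_
  rw [← C_mul_X_pow_eq_monomial, map_mul, map_pow, AdjoinRoot.mk_X, AdjoinRoot.mk_C,
    Algebra.smul_def, AdjoinRoot.algebraMap_eq]

/-- `φ e_j = x^j`. [folklore] -/
private theorem φ_single [NeZero ℓ] (j : Fin ℓ) :
    φ F ℓ (Pi.single j 1) = AdjoinRoot.root ((X : F[X]) ^ ℓ - 1) ^ (j : ℕ) := by
  rw [φ_apply, Finset.sum_eq_single j]
  · simp
  · intro i _ hij
    simp [hij]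
  · intro h
    exact absurd (Finset.mem_univ j) h

/-- `φ (circulant a · e_j) = a(x) · x^j`. [folklore] -/
private theorem φ_circulant_col [NeZero ℓ] (a : Fin ℓ → F) (j : Fin ℓ) :
    φ F ℓ (fun i => a (i - j)) =
      AdjoinRoot.mk ((X : F[X]) ^ ℓ - 1) (GBDim.vecPoly a) * AdjoinRoot.root ((X : F[X]) ^ ℓ - 1) ^ (j : ℕ) := by
  rw [mk_vecPoly, φ_apply, φ_apply, Finset.sum_mul]
  simp_rw [smul_mul_assoc, ← pow_add]
  refine (Fintype.sum_equiv (Equiv.addRight j) _ _ fun i => ?_).symm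
  simp only [Equiv.coe_addRight, add_sub_cancel_right]
  congr 1
  rw [root_pow_eq_pow_mod ((i : ℕ) + (j : ℕ)), Fin.val_add]

/-- Multiplication by `circulant a` is multiplication by `a(x)` in `F[x]/(x^ℓ − 1)`.
[cite: WangPryadko2022, §3.1 "it is convenient to represent … circulant matrices … by polynomials modulo x^ℓ − 1" (arXiv:2203.17216 chunk p0006 L1–30)] -/
theorem φ_mulVec_circulant [NeZero ℓ] (a v : Fin ℓ → F) :
    AdjoinRoot.mk ((X : F[X]) ^ ℓ - 1) (GBDim.vecPoly (circulant a *ᵥ v)) =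
      AdjoinRoot.mk ((X : F[X]) ^ ℓ - 1) (GBDim.vecPoly a * GBDim.vecPoly v) := by
  rw [map_mul, mk_vecPoly (circulant a *ᵥ v), mk_vecPoly v]
  suffices h : (φ F ℓ).toLinearMap ∘ₗ (circulant a).mulVecLin =
      LinearMap.mulLeft F (AdjoinRoot.mk ((X : F[X]) ^ ℓ - 1) (GBDim.vecPoly a)) ∘ₗ (φ F ℓ).toLinearMap by
    simpa using LinearMap.congr_fun h v
  refine (Pi.basisFun F (Fin ℓ)).ext fun j => ?_
  simp only [Pi.basisFun_apply, LinearMap.coe_comp, Function.comp_apply, Matrix.mulVecLin_apply,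
    LinearEquiv.coe_coe, LinearMap.mulLeft_apply]
  rw [Matrix.mulVec_single_one, φ_single, ← φ_circulant_col]
  rfl

/-- `GBDim.vecPoly` is injective modulo `x^ℓ − 1`: `GBDim.vecPoly u ≡ GBDim.vecPoly v ⇒ u = v`. [folklore] -/
private theorem eq_of_mk_vecPoly_eq [NeZero ℓ] {u v : Fin ℓ → F}
    (h : AdjoinRoot.mk ((X : F[X]) ^ ℓ - 1) (GBDim.vecPoly u) = AdjoinRoot.mk ((X : F[X]) ^ ℓ - 1) (GBDim.vecPoly v)) :
    u = v := by
  rw [mk_vecPoly, mk_vecPoly] at h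
  exact (φ F ℓ).injective h

/-- `circulant a *ᵥ v = 0 ↔ (x^ℓ − 1) ∣ a(x) v(x)`. [cite: WangPryadko2022, §3.1 (arXiv:2203.17216 chunk p0006 L1–30)] -/
theorem circulant_mulVec_eq_zero_iff [NeZero ℓ] (a v : Fin ℓ → F) :
    circulant a *ᵥ v = 0 ↔ ((X : F[X]) ^ ℓ - 1) ∣ GBDim.vecPoly a * GBDim.vecPoly v := by
  rw [← AdjoinRoot.mk_eq_zero, ← φ_mulVec_circulant]
  constructor
  · intro h
    rw [h, GBDim.vecPoly]
    simp
  · intro h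
    apply eq_of_mk_vecPoly_eq (F := F) (ℓ := ℓ)
    rw [h, GBDim.vecPoly]
    simp

/-- `circulant a *ᵥ v = e ↔ (x^ℓ − 1) ∣ e(x) − a(x) v(x)`. [cite: WangPryadko2022, §3.1 (arXiv:2203.17216 chunk p0006 L1–30)] -/
theorem circulant_mulVec_eq_iff [NeZero ℓ] (a v e : Fin ℓ → F) :
    circulant a *ᵥ v = e ↔ ((X : F[X]) ^ ℓ - 1) ∣ GBDim.vecPoly e - GBDim.vecPoly a * GBDim.vecPoly v := by
  rw [← AdjoinRoot.mk_eq_mk, ← φ_mulVec_circulant]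
  constructor
  · intro h; rw [h]
  · intro h; exact (eq_of_mk_vecPoly_eq h).symm

end Circ

/-! ### The two-block row space of `H_Z` in block form -/

section RowSpace

variable {F : Type*} [CommRing F] {ℓ : ℕ}

/-- `(u, v) ∈ rowspace H_Z ↔ ∃ w, u = B w ∧ v = A w` for `H_Z = [Bᵀ|Aᵀ]`.
[cite: WangPryadko2022, §3.1 degeneracy condition `(u, v) = α(x)(b(x), −a(x))` (arXiv:2203.17216 chunk p0013 L55–62), char-free form with the tree's sign convention `H_Z = [Bᵀ|Aᵀ]`] -/
theorem sumElim_mem_range_vecMulLinear_HZ_iff [NeZero ℓ] (a b u v : Fin ℓ → F) :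
    Sum.elim u v ∈ LinearMap.range (AbelianTwoBlock.HZ a b).vecMulLinear ↔
      ∃ w, circulant b *ᵥ w = u ∧ circulant a *ᵥ w = v := by
  simp only [LinearMap.mem_range, Matrix.vecMulLinear_apply, AbelianTwoBlock.HZ_def,
    Matrix.vecMul_fromCols, Matrix.vecMul_transpose]
  constructor
  · rintro ⟨w, hw⟩
    refine ⟨w, ?_, ?_⟩
    · funext i; simpa using congr_fun hw (Sum.inl i)
    · funext i; simpa using congr_fun hw (Sum.inr i)
  · rintro ⟨w, hu, hv⟩
    exact ⟨w, by rw [hu, hv]⟩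

/-- `H_X (e, 0) = A e` and `H_X (0, e) = B e`. [cite: WangPryadko2022, §3.1 `a(x)u(x) + b(x)v(x) = 0` (arXiv:2203.17216 chunk p0013 L50–53)] -/
theorem HX_mulVec_sumElim [NeZero ℓ] (a b u v : Fin ℓ → F) :
    AbelianTwoBlock.HX a b *ᵥ Sum.elim u v = circulant a *ᵥ u + circulant b *ᵥ v := by
  rw [AbelianTwoBlock.HX_def, Matrix.fromCols_mulVec_sumElim]

end RowSpace

/-! ### Statement 2 in strong form: `(e,0)` and `(0,e)` are not both stabilizers -/

section Main

variable {F : Type*} [Field F] {ℓ : ℕ}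

/-- **"Either `[e(x), 0]` or `[0, e(x)]` is a non-trivial `Z`-vector"** — for every cyclic group
`ℤ_ℓ`, every field `F`, every `a, b` and every non-zero `e` with `A e = 0`, `B e = 0` (`e` in the
cyclic code `ker A ∩ ker B = 𝒞_g`), the `Z`-type vectors `(e, 0)` and `(0, e)` are not both in the
row space of `H_Z = [Bᵀ|Aᵀ]`. [cite: WangPryadko2022, §3.1 Statement 2 and the sentence after it (arXiv:2203.17216 chunk p0006 L100–110); proof §6.3 (chunk p0013 L113–141)] -/
theorem not_both_trivial [NeZero ℓ] (a b e : Fin ℓ → F) (he : e ≠ 0)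
    (h₁ : Sum.elim e (0 : Fin ℓ → F) ∈ LinearMap.range (AbelianTwoBlock.HZ a b).vecMulLinear)
    (h₂ : Sum.elim (0 : Fin ℓ → F) e ∈ LinearMap.range (AbelianTwoBlock.HZ a b).vecMulLinear) :
    False := by
  obtain ⟨w₁, hbw₁, haw₁⟩ := (sumElim_mem_range_vecMulLinear_HZ_iff a b e 0).mp h₁
  obtain ⟨w₂, hbw₂, haw₂⟩ := (sumElim_mem_range_vecMulLinear_HZ_iff a b 0 e).mp h₂
  have H1 : ((X : F[X]) ^ ℓ - 1) ∣ GBDim.vecPoly a * GBDim.vecPoly w₁ := (circulant_mulVec_eq_zero_iff a w₁).mp haw₁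
  have H2 : ((X : F[X]) ^ ℓ - 1) ∣ GBDim.vecPoly e - GBDim.vecPoly b * GBDim.vecPoly w₁ :=
    (circulant_mulVec_eq_iff b w₁ e).mp hbw₁
  have H3 : ((X : F[X]) ^ ℓ - 1) ∣ GBDim.vecPoly b * GBDim.vecPoly w₂ := (circulant_mulVec_eq_zero_iff b w₂).mp hbw₂
  have H4 : ((X : F[X]) ^ ℓ - 1) ∣ GBDim.vecPoly e - GBDim.vecPoly a * GBDim.vecPoly w₂ :=
    (circulant_mulVec_eq_iff a w₂ e).mp haw₂
  have hdvd : ((X : F[X]) ^ ℓ - 1) ∣ GBDim.vecPoly e := dvd_of_trivial_pair _ H1 H2 H3 H4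
  apply he
  -- `x^ℓ − 1 ∣ e(x)` means `circulant 1 … e = 0`; use the intertwiner with `a = Pi.single 0 1`
  have : circulant (Pi.single (0 : Fin ℓ) (1 : F)) *ᵥ e = 0 := by
    rw [circulant_mulVec_eq_zero_iff]
    exact dvd_mul_of_dvd_right hdvd _
  simpa [Matrix.circulant_single_one] using this

/-- The cyclic code `ker A ∩ ker B` contains every multiple of `g = (x^ℓ − 1)/h`,
`h = gcd(a, b, x^ℓ − 1)`: if `h · g = x^ℓ − 1` and `g ∣ e(x)` then `A e = 0` and `B e = 0`.
[cite: WangPryadko2022, §3.1 `h(x) = gcd(a, b, x^ℓ − 1)`, `𝒞_{h}^⊥ ≡ 𝒞_g` (arXiv:2203.17216 chunk p0006 L40–48) and §6.3 "e(x) = i(x) g(x)" (chunk p0013 L116)] -/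
theorem mulVec_eq_zero_of_generator_dvd [NeZero ℓ] [DecidableEq F] (a b e : Fin ℓ → F) {g : F[X]}
    (hg : EuclideanDomain.gcd (EuclideanDomain.gcd (GBDim.vecPoly a) (GBDim.vecPoly b)) ((X : F[X]) ^ ℓ - 1) * g =
      (X : F[X]) ^ ℓ - 1)
    (he : g ∣ GBDim.vecPoly e) : circulant a *ᵥ e = 0 ∧ circulant b *ᵥ e = 0 := by
  set h := EuclideanDomain.gcd (EuclideanDomain.gcd (GBDim.vecPoly a) (GBDim.vecPoly b)) ((X : F[X]) ^ ℓ - 1)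
    with hh
  have ha : h ∣ GBDim.vecPoly a :=
    dvd_trans (EuclideanDomain.gcd_dvd_left _ _) (EuclideanDomain.gcd_dvd_left _ _)
  have hb : h ∣ GBDim.vecPoly b :=
    dvd_trans (EuclideanDomain.gcd_dvd_left _ _) (EuclideanDomain.gcd_dvd_right _ _)
  obtain ⟨t, ht⟩ := he
  constructor
  · rw [circulant_mulVec_eq_zero_iff, ← hg, ht]
    obtain ⟨a', ha'⟩ := ha
    exact ⟨a' * t, by rw [ha']; ring⟩
  · rw [circulant_mulVec_eq_zero_iff, ← hg, ht]
    obtain ⟨b', hb'⟩ := hb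
    exact ⟨b' * t, by rw [hb']; ring⟩

end Main

/-! ### The distance bound for the tree's CSS code over `𝔽₂` -/

section Distance

variable {ℓ : ℕ}

/-- `|(u, v)| = |u| + |v|`. [folklore] -/
private theorem hammingNorm_sumElim {α β R : Type*} [Fintype α] [Fintype β] [Zero R] [DecidableEq R]
    (u : α → R) (v : β → R) : hammingNorm (Sum.elim u v) = hammingNorm u + hammingNorm v := by
  unfold hammingNorm
  rw [← Finset.card_disjSum]
  congr 1
  ext i
  rcases i with i | i <;> simp [Finset.mem_disjSum]

/-- **`d_Z(GB(a,b)) ≤ |e|` for every non-zero `e ∈ ker A ∩ ker B`** (`ℤ_ℓ`, `𝔽₂`).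
[cite: WangPryadko2022, §3.1 Statement 2 with Statement 1 "the CSS distance d_Z' (and thus the distance d of the GB code) is bounded by the distance d_g" (arXiv:2203.17216 chunk p0006 L96–104)] -/
theorem css_dZ_le_hammingNorm [NeZero ℓ] (a b e : Fin ℓ → ZMod 2) (he : e ≠ 0)
    (hA : circulant a *ᵥ e = 0) (hB : circulant b *ᵥ e = 0) :
    (AbelianTwoBlock.css a b).dZ ≤ hammingNorm e := by
  by_cases h₁ : Sum.elim e (0 : Fin ℓ → ZMod 2) ∈ LinearMap.range (AbelianTwoBlock.HZ a b).vecMulLinear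
  · -- then `(0, e)` is the non-trivial one
    have h₂ : Sum.elim (0 : Fin ℓ → ZMod 2) e ∉ LinearMap.range (AbelianTwoBlock.HZ a b).vecMulLinear :=
      fun h₂ => not_both_trivial a b e he h₁ h₂
    have hker : (AbelianTwoBlock.css a b).HX *ᵥ Sum.elim (0 : Fin ℓ → ZMod 2) e = 0 := by
      rw [AbelianTwoBlock.css_HX, HX_mulVec_sumElim, Matrix.mulVec_zero, zero_add, hB]
    have hw : hammingNorm (Sum.elim (0 : Fin ℓ → ZMod 2) e) = hammingNorm e := by
      rw [hammingNorm_sumElim, hammingNorm_zero, zero_add]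
    rw [← hw]
    exact (AbelianTwoBlock.css a b).dZ_le_hammingNorm hker h₂
  · have hker : (AbelianTwoBlock.css a b).HX *ᵥ Sum.elim e (0 : Fin ℓ → ZMod 2) = 0 := by
      rw [AbelianTwoBlock.css_HX, HX_mulVec_sumElim, Matrix.mulVec_zero, add_zero, hA]
    have hw : hammingNorm (Sum.elim e (0 : Fin ℓ → ZMod 2)) = hammingNorm e := by
      rw [hammingNorm_sumElim, hammingNorm_zero, add_zero]
    rw [← hw]
    exact (AbelianTwoBlock.css a b).dZ_le_hammingNorm hker h₁

/-- **`d_X(GB(a,b)) ≤ |e|`** likewise (`d_X = d_Z` for abelian two-block codes, the tree's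
`AbelianTwoBlock.css_dX_eq_dZ`). [cite: WangPryadko2022, §3.1 "the CSS distances of any GB code are equal to each other and, respectively, to the code distance d" (arXiv:2203.17216 chunk p0006 L50–53) and Statement 2 (L100–104)] -/
theorem css_dX_le_hammingNorm [NeZero ℓ] (a b e : Fin ℓ → ZMod 2) (he : e ≠ 0)
    (hA : circulant a *ᵥ e = 0) (hB : circulant b *ᵥ e = 0) :
    (AbelianTwoBlock.css a b).dX ≤ hammingNorm e := by
  rw [AbelianTwoBlock.css_dX_eq_dZ]
  exact css_dZ_le_hammingNorm a b e he hA hB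

/-- **Statement 2 as printed, `d ≤ d_g`:** every non-zero codeword `e(x) = i(x) g(x)` of the cyclic
code generated by `g(x) = (x^ℓ − 1)/gcd(a, b, x^ℓ − 1)` bounds both CSS distances of `GB(a,b)`:
`d_Z ≤ |e|` and `d_X ≤ |e|`. [cite: WangPryadko2022, §3.1 Statement 2 (arXiv:2203.17216 chunk p0006 L100–104); proof §6.3 (chunk p0013 L113–141)] -/
theorem css_dZ_le_of_generator_dvd [NeZero ℓ] (a b e : Fin ℓ → ZMod 2) {g : (ZMod 2)[X]}
    (hg : EuclideanDomain.gcd (EuclideanDomain.gcd (GBDim.vecPoly a) (GBDim.vecPoly b)) ((X : (ZMod 2)[X]) ^ ℓ - 1) * g =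
      (X : (ZMod 2)[X]) ^ ℓ - 1)
    (hge : g ∣ GBDim.vecPoly e) (he : e ≠ 0) :
    (AbelianTwoBlock.css a b).dZ ≤ hammingNorm e ∧ (AbelianTwoBlock.css a b).dX ≤ hammingNorm e := by
  obtain ⟨hA, hB⟩ := mulVec_eq_zero_of_generator_dvd a b e hg hge
  exact ⟨css_dZ_le_hammingNorm a b e he hA hB, css_dX_le_hammingNorm a b e he hA hB⟩

end Distance

end GB

end Literature.InformationTheory.QuantumCodes
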